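import Literature.NumberTheory.PAdicHodge.UnitRootFrameReciprocity
import Literature.NumberTheory.PAdicHodge.UnitRootFrameKummerPackage
import Literature.NumberTheory.PAdicHodge.UnitRootFrameData
import HarnessLib

/-!
# Kato's explicit reciprocity law at a completion for a ramified good ORDINARY model `W_D ≡ E₀ (mod ϖ)` at deep formal points with a formal
# division tower — the unit-root frame assembled

Topic `Literature/NumberTheory/PAdicHodge`; THEOREMS ONLY. The ORDINARY twin of
`BmaxPlusTransportedReciprocityFormalPoint.exists_const_tatePairingPoint_eq_neg_trace_transported_formalPoint` (line `kato_lever`, crux K★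
`stmt-BirchSwinnertonDyer-22226`, stub `stub_localFormulaOrdinaryCells`; memo `…/kato-lever-seam-rec-at-cells.md` §17 «UNIT-ROOT FRAME»):
`UnitRootFrameData` (frame data) ⟶ `UnitRootFrameReciprocity` (the law in the frame, ONE constant `c`) ⟵ `UnitRootFrameKummerPackage` (per point).

* ★★★★ `exists_const_tatePairingPoint_eq_neg_trace_unitRoot_formalPoint` — GIVEN the cell data (Weil tower, `ψ = log χ`, de Rham binders), the
  transported period map `LT` at an index `N ≥ e` (`exists_addMonoidHom_logSum_transport`), a generator `v₀` of `T_pŴ_D` with its character `ρ`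
  (`FormalTateModuleRankOne.exists_generator_tatePtO_of_isUnit`), a Hodge line `(A, B, d)`, the unit root `α` of `X² − a_p(E₀)X + p`
  (`p ∤ a_p(E₀)`: ORDINARY) and the single non-vanishing input `H₀ = ι(A)f(LT v₀) + ι(B)fφ(LT v₀) ≠ 0`, there is ONE `c ∈ F` such that for every
  cocycle `η`, every `P ∈ E(F)` with a `p`-power division tower `Q` of FORMAL algebraic points (`Q₀ = P`, `‖z(P)‖^N ≤ ‖p‖`) and every `c_P`
  with `ι(c_P) = p^N·Σ'[Xʲ]log_{W_D}·z(P)ʲ`: **`⟨[η], P⟩ = −Tr_{F/ℚ_p}(c_P · exp*_d(η) · c)`.**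

HONEST LIMITS: compared with the supersingular twin, two inputs remain to be discharged by the cells / later files: the existence of a FORMAL algebraic
division tower above a deep point at ordinary reduction (`[p]` is onto `Ŵ(𝔪_ℂ)`, `FormalGroupDivisionHeightOne`; plus `E[pⁿ](ℂ_F) ⊆ E(F̄)`), and
`H₀ ≠ 0`. BSD / K★ (`stmt-BirchSwinnertonDyer-22226`) / [REC-tower] are NOT proved by this file.

## References
* K. Kato, LNM 1553 (1993), Ch. II Thm. 1.4.1, §1.4, Lemma 1.4.3. [Kato1993LNM1553]
* S. Bloch, K. Kato (1990), Ex. 3.10.1, Example 3.11. [BlochKato1990]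
* P. Colmez, Math. Ann. 292 (1992), §2. [Colmez1992PeriodesAbeliennes]
* J. Tate, *p-divisible groups* (1967), §4. [Tate1967]
* J. H. Silverman, *AEC* (2009), Prop. VII.2.2, VIII §2. [SilvermanAEC2009]
-/

noncomputable section

open Field Function ValuativeRel WittVector NumberField IsDedekindDomain
open scoped NumberField Topology

namespace Literature.NumberTheory.PAdicHodge

open Literature.NumberTheory.GaloisRepresentations
open Literature.NumberTheory.GaloisRepresentations.IsNonarchimedeanLocalField
open Literature.NumberTheory.GaloisRepresentations.LubinTate
open Literature.NumberTheory.GaloisCohomology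
open Literature.NumberTheory.EllipticCurves
open Literature.NumberTheory.EllipticCurves.FormalGroupChart
open Literature.NumberTheory.PAdicHodge.GaloisContinuity
open Literature.IUT.LogVolume
open Literature.RingTheory.FormalGroups Literature.AlgebraicGeometry.Resolution
open _root_.WeierstrassCurve

section Completion

variable {K : Type} [Field K] [NumberField K] {p : ℕ} [hprime : Fact p.Prime] (v : HeightOneSpectrum (𝓞 K))
  [CharZero (v.adicCompletion K)] [LocallyCompactSpace (absoluteGaloisGroup (v.adicCompletion K))]
  [Fact (¬ IsUnit (p : integerC (v.adicCompletion K)))]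
  [IsAdicComplete (Ideal.span {(p : integerC (v.adicCompletion K))}) (integerC (v.adicCompletion K))]
  [CharP 𝓀[v.adicCompletion K] p] [CharZero (CompletedAlgClosure (v.adicCompletion K))]
  (hpv : valuation (v.adicCompletion K) (p : v.adicCompletion K) < 1)
  (Dv : EisensteinRoot (v.adicCompletion K) p hpv) (Wm : WeierstrassCurve (EisensteinRoot.CoeffDisc Dv))
  (ψm : EisensteinRoot.CoeffDisc Dv →+* LTCoeff (v.adicCompletion K))
  (hψm : ∀ c, algebraMap (LTCoeff (v.adicCompletion K)) (v.adicCompletion K) (ψm c) = EisensteinRoot.CoeffDisc.toF Dv c)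
  (hΔ : IsUnit (Wm.map ψm).Δ)
  [(AinfTop.curveFO (v.adicCompletion K) (Wm.map ψm)).IsElliptic]
  [(curveOver (CompletedAlgClosure (v.adicCompletion K)) (Wm.map ψm)).IsElliptic]
  (e : (k : ℕ) → geomTorsion (AinfTop.curveFO (v.adicCompletion K) (Wm.map ψm)) ((p ^ k : ℕ) : ℤ) →
    geomTorsion (AinfTop.curveFO (v.adicCompletion K) (Wm.map ψm)) ((p ^ k : ℕ) : ℤ) → AlgebraicClosure (v.adicCompletion K))
  (hμ : ∀ k S T, e k S T ^ (p ^ k) = 1) (hadd₁ : ∀ k S₁ S₂ T, e k (S₁ + S₂) T = e k S₁ T * e k S₂ T)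
  (hadd₂ : ∀ k S T₁ T₂, e k S (T₁ + T₂) = e k S T₁ * e k S T₂)
  (hgal : ∀ k (σ : absoluteGaloisGroup (v.adicCompletion K))
    (S T : geomTorsion (AinfTop.curveFO (v.adicCompletion K) (Wm.map ψm)) ((p ^ k : ℕ) : ℤ)), σ • e k S T = e k (σ • S) (σ • T))
  (hcompat : ∀ k (S T : geomTorsion (AinfTop.curveFO (v.adicCompletion K) (Wm.map ψm)) ((p ^ (k + 1) : ℕ) : ℤ)),
    e k (torsionMulHom (AinfTop.curveFO (v.adicCompletion K) (Wm.map ψm)) (p ^ (k + 1)) (p ^ k) p (pow_succ p k).symm S)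
      (torsionMulHom (AinfTop.curveFO (v.adicCompletion K) (Wm.map ψm)) (p ^ (k + 1)) (p ^ k) p (pow_succ p k).symm T) =
        e (k + 1) S T ^ p)

set_option maxHeartbeats 6400000 in
include hgal hψm hΔ in
/-- ★★★★ **Kato's explicit reciprocity law at `F = K_v` for a ramified good ORDINARY model, at every cocycle and every deep formal point WITH A
FORMAL DIVISION TOWER — the unit-root frame assembled.** Inputs: the cell data (Weil tower `e` with `heL/healt/henondeg`, `ψ = log χ`,
`hinj / hde / d`), `W_D ≡ E₀ (mod ϖ)` with `E₀` good at `p` (fibres elliptic), the transported period map `LT` at `N ≥ e` (specification,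
`ℤ_p`-linearity, equivariance), a generator `v₀` of `T_pŴ_D` with character `ρ`, a Hodge line `(A, B, d)`, the unit root `α` (`‖α‖ = 1`,
`α² − a_pα + p = 0`, `απ = p`, `α + π = a_p`) and `H₀ ≠ 0`. Then ONE `c ∈ F` gives, for every `η`, every `P ∈ E(F)` with a `p`-power division
tower `Q` of formal algebraic points (`Q₀ = P`, `‖z(P)‖^N ≤ ‖p‖`) and every `c_P` with `ι(c_P) = p^N·Σ'[Xʲ]log_{W_D}·z(P)ʲ`:
**`⟨[η], P⟩ = −Tr_{F/ℚ_p}(c_P · exp*_d(η) · c)`.** [cite: Kato1993LNM1553, Ch. II Thm. 1.4.1 (3)–(4) and Lemma 1.4.3]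
[cite: BlochKato1990, Ex. 3.10.1, Example 3.11] [cite: Colmez1992PeriodesAbeliennes, §2] [cite: Tate1967, §4] [cite: SilvermanAEC2009, Prop. VII.2.2 and VIII §2] -/
theorem exists_const_tatePairingPoint_eq_neg_trace_unitRoot_formalPoint
    (E₀ : WeierstrassCurve ℤ)
    (hWE : Wm.map (Ideal.Quotient.mk (Ideal.span {EisensteinRoot.CoeffDisc.of Dv (AdjoinRoot.root Dv.poly)})) =
      (E₀.map (algebraMap ℤ (EisensteinRoot.CoeffDisc Dv))).map
        (Ideal.Quotient.mk (Ideal.span {EisensteinRoot.CoeffDisc.of Dv (AdjoinRoot.root Dv.poly)})))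
    [(E₀.map (Int.castRingHom ℚ_[p])).IsElliptic] [(E₀.map (Int.castRingHom (ZMod p))).IsElliptic]
    {N : ℕ} (hN : Dv.e ≤ N) {LT : AinfTop.TatePtO (v.adicCompletion K) (Wm.map ψm) p →+ BmaxPlus (v.adicCompletion K) p}
    (hLT : ∀ (τ : AinfTop.TatePtO (v.adicCompletion K) (Wm.map ψm) p) (w : ℕ → (maxNilIdealC (v.adicCompletion K)).toIdeal)
        (hw : ∀ n, AinfTop.mulPC (v.adicCompletion K) p E₀ (w (n + 1)) = w n)
        (_ : ∀ n, ‖(((w n : (maxNilIdealC (v.adicCompletion K)).toIdeal) : CBall (v.adicCompletion K)) : CompletedAlgClosure (v.adicCompletion K)) -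
          (((AinfTop.seqO (Wm.map ψm) τ n : (maxNilIdealC (v.adicCompletion K)).toIdeal) : CBall (v.adicCompletion K)) :
            CompletedAlgClosure (v.adicCompletion K))‖ ≤
          ‖((Dv.rootC : integerC (v.adicCompletion K)) : CompletedAlgClosure (v.adicCompletion K))‖)
        (z : bmaxZero (v.adicCompletion K) p), algebraMap (Ainf (p := p) (v.adicCompletion K)) (bmaxZero (v.adicCompletion K) p)
          ((AinfTop.of (v.adicCompletion K) p).symm (((AinfTop.divisionLiftPt E₀ (surjective_fontaineTheta_integerC hpv) w hw).val :
            (AinfTop.nilTheta (v.adicCompletion K) p (surjective_fontaineTheta_integerC hpv)).toIdeal) : AinfTop (v.adicCompletion K) p)) ^ N =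
          (p : bmaxZero (v.adicCompletion K) p) * z →
        LT τ = PadicLogSeries.logSum ((algebraMap (Ainf (p := p) (v.adicCompletion K)) (bmaxZero (v.adicCompletion K) p)).comp zpToAinf)
          (GaloisContinuity.formalLogNum E₀ p) N
          (algebraMap (Ainf (p := p) (v.adicCompletion K)) (bmaxZero (v.adicCompletion K) p)
            ((AinfTop.of (v.adicCompletion K) p).symm (((AinfTop.divisionLiftPt E₀ (surjective_fontaineTheta_integerC hpv) w hw).val :
              (AinfTop.nilTheta (v.adicCompletion K) p (surjective_fontaineTheta_integerC hpv)).toIdeal) : AinfTop (v.adicCompletion K) p))) z)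
    (hsmul : ∀ (c : ℤ_[p]) (τ : AinfTop.TatePtO (v.adicCompletion K) (Wm.map ψm) p),
      LT (c • τ) = ainfToBmaxPlus (v.adicCompletion K) p (zpToAinf c) * LT τ)
    (hgalLT : ∀ (σ : absoluteGaloisGroup (v.adicCompletion K)) (τ : AinfTop.TatePtO (v.adicCompletion K) (Wm.map ψm) p),
      galBmaxPlus σ (LT τ) = LT (σ • τ))
    {v₀ : AinfTop.TatePtO (v.adicCompletion K) (Wm.map ψm) p} (hv₀ : v₀ ≠ 0)
    (hgen : ∀ τ : AinfTop.TatePtO (v.adicCompletion K) (Wm.map ψm) p, ∃ c : ℤ_[p], τ = c • v₀)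
    (ρ : absoluteGaloisGroup (v.adicCompletion K) → ℤ_[p]) (hρv : ∀ σ : absoluteGaloisGroup (v.adicCompletion K), σ • v₀ = ρ σ • v₀)
    (A B : v.adicCompletion K) (dHL : ℕ)
    (hHL : ∀ n : ℕ, ‖(p : CompletedAlgClosure (v.adicCompletion K)) ^ dHL * PowerSeries.coeff n
        ((Wm.map ((CBall (v.adicCompletion K)).subtype.comp (EisensteinRoot.CoeffDisc.toCBall Dv))).formalLog -
          PowerSeries.C (algebraMap (v.adicCompletion K) (CompletedAlgClosure (v.adicCompletion K)) A) *
            (E₀.map (Int.castRingHom (CompletedAlgClosure (v.adicCompletion K)))).formalLog -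
          PowerSeries.C (algebraMap (v.adicCompletion K) (CompletedAlgClosure (v.adicCompletion K)) B) *
            PowerSeries.expand p hprime.out.ne_zero (E₀.map (Int.castRingHom (CompletedAlgClosure (v.adicCompletion K)))).formalLog)‖ ≤ 1)
    {α π : ℤ_[p]} (hα : ‖α‖ = 1) (hαπ : α * π = p)
    (hαroot : α ^ 2 - ((HasseManin.tr (E₀.map (Int.castRingHom (ZMod p))) : ℤ) : ℤ_[p]) * α + p = 0)
    (haπ : α + π = ((HasseManin.tr (E₀.map (Int.castRingHom (ZMod p))) : ℤ) : ℤ_[p]))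
    (hne : embBdRHom hpv (surjective_fontaineTheta_integerC hpv) A * bmaxPlusToBdR (v.adicCompletion K) p (LT v₀) +
      embBdRHom hpv (surjective_fontaineTheta_integerC hpv) B * bmaxPlusToBdR (v.adicCompletion K) p (frobBmaxPlus (v.adicCompletion K) p (LT v₀)) ≠ 0)
    (ψ : C(absoluteGaloisGroup (v.adicCompletion K), ℤ_[p])) (hψ : ∀ σ τ, ψ (σ * τ) = ψ σ + ψ τ)
    (hψlog : ∀ τ, (ψ τ : ℚ_[p]) = logCyclotomic (F := (v.adicCompletion K)) p τ)
    (heL : ∀ (c : ℤ_[p]) (S U : (AinfTop.curveFO (v.adicCompletion K) (Wm.map ψm)).tateModule p),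
      (weilContPairingPadic (AinfTop.curveFO (v.adicCompletion K) (Wm.map ψm)) (v.adicCompletion K) p e hμ hadd₁ hadd₂ hgal hcompat).toLin (c • S) U =
      twistHom (v.adicCompletion K) p ((weilContPairingPadic (AinfTop.curveFO (v.adicCompletion K) (Wm.map ψm)) (v.adicCompletion K) p e hμ hadd₁ hadd₂ hgal hcompat).toLin S U) c)
    (healt : ∀ S : (AinfTop.curveFO (v.adicCompletion K) (Wm.map ψm)).tateModule p,
      (weilContPairingPadic (AinfTop.curveFO (v.adicCompletion K) (Wm.map ψm)) (v.adicCompletion K) p e hμ hadd₁ hadd₂ hgal hcompat).toLin S S = 0)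
    (henondeg : ∀ S : (AinfTop.curveFO (v.adicCompletion K) (Wm.map ψm)).tateModule p,
      (∀ U, (weilContPairingPadic (AinfTop.curveFO (v.adicCompletion K) (Wm.map ψm)) (v.adicCompletion K) p e hμ hadd₁ hadd₂ hgal hcompat).toLin S U = 0) → S = 0)
    (hinj : letI := LocalField.padicAlgebra (v.adicCompletion K) p hpv
      (bdRPeriodRingData (F := (v.adicCompletion K)) (p := p) hpv).CupLogInjective (logCyclotomic p)
        (restrictedRationalTateRep (AinfTop.curveFO (v.adicCompletion K) (Wm.map ψm)) (v.adicCompletion K) p))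
    (hde : letI := LocalField.padicAlgebra (v.adicCompletion K) p hpv
      ∀ η : contOneCocycles (restrictedTateRep (AinfTop.curveFO (v.adicCompletion K) (Wm.map ψm)) (v.adicCompletion K) p).toTopRep,
        (bdRPeriodRingData (F := (v.adicCompletion K)) (p := p) hpv).HasDualExp (logCyclotomic p)
          (restrictedRationalTateRep (AinfTop.curveFO (v.adicCompletion K) (Wm.map ψm)) (v.adicCompletion K) p)
          fun σ => TateModule.toRational p (η.1 σ))
    (d : letI := LocalField.padicAlgebra (v.adicCompletion K) p hpv
      (bdRPeriodRingData (F := (v.adicCompletion K)) (p := p) hpv).FilZeroLine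
        (restrictedRationalTateRep (AinfTop.curveFO (v.adicCompletion K) (Wm.map ψm)) (v.adicCompletion K) p)) :
    letI := LocalField.padicAlgebra (v.adicCompletion K) p hpv
    ∃ c : v.adicCompletion K,
      ∀ (η : contOneCocycles (restrictedTateRep (AinfTop.curveFO (v.adicCompletion K) (Wm.map ψm)) (v.adicCompletion K) p).toTopRep)
        (P : ((AinfTop.curveFO (v.adicCompletion K) (Wm.map ψm)).baseChange (v.adicCompletion K)).toAffine.Point)
        (Q : ℕ → geomPoints ((AinfTop.curveFO (v.adicCompletion K) (Wm.map ψm)).baseChange (v.adicCompletion K)))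
        (_hQ : ∀ n, p • Q (n + 1) = Q n)
        (_hQ0 : Q 0 = toGeomPoints ((AinfTop.curveFO (v.adicCompletion K) (Wm.map ψm)).baseChange (v.adicCompletion K)) P)
        (hker : ∀ n, AinfTop.geomToCO (Wm.map ψm) (Q n) ∈ kernel (NormedField.valuation (K := CompletedAlgClosure (v.adicCompletion K)))
          (curveOver (CompletedAlgClosure (v.adicCompletion K)) (Wm.map ψm))),
        ‖((zPt (AinfTop.geomToCO (Wm.map ψm) (Q 0)) (hker 0) : CBall (v.adicCompletion K)) : CompletedAlgClosure (v.adicCompletion K))‖ ^ N ≤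
            ‖(p : CompletedAlgClosure (v.adicCompletion K))‖ →
        ∀ cP : v.adicCompletion K,
          algebraMap (v.adicCompletion K) (CompletedAlgClosure (v.adicCompletion K)) cP =
            (p : CompletedAlgClosure (v.adicCompletion K)) ^ N *
              ∑' j : ℕ, PowerSeries.coeff j (Wm.map ((CBall (v.adicCompletion K)).subtype.comp (EisensteinRoot.CoeffDisc.toCBall Dv))).formalLog *
                ((zPt (AinfTop.geomToCO (Wm.map ψm) (Q 0)) (hker 0) : CBall (v.adicCompletion K)) : CompletedAlgClosure (v.adicCompletion K)) ^ j →
          ((tatePairingPoint (AinfTop.curveFO (v.adicCompletion K) (Wm.map ψm)) (v.adicCompletion K) p e hμ hadd₁ hadd₂ hgal hcompat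
              (oneCocycleClass _ η) P : ℤ_[p]) : ℚ_[p]) =
            -Algebra.trace ℚ_[p] (v.adicCompletion K) (cP * (expStarCoord (AinfTop.curveFO (v.adicCompletion K) (Wm.map ψm)) hpv d η * c)) := by
  -- the frame data (generic `F`, STEPWISE)
  have hD1 := restrictedTateRep_frameVector (hp := hpv) (D := Dv) (W := Wm) (ψ := ψm) hΔ hv₀ ρ hρv
  obtain ⟨hw₀, hρ0, hρw⟩ := hD1
  have hD2 := framePeriod_honda_gal_theta (hp := hpv) (D := Dv) (W := Wm) (E₀ := E₀) hWE (ψ := ψm) hψm hN hLT hsmul hgalLT v₀ ρ hρv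
    A B dHL hHL haπ
  obtain ⟨hx, hρx, hfil⟩ := hD2
  have hD3 := exists_unitRootPeriod_and_ne_cyclotomic (hp := hpv) (E₀ := E₀) hα hαπ hαroot hx ρ hρx hfil hne
  obtain ⟨u, hu, hφu, hρχ⟩ := hD3
  -- the law in the frame
  have hF1 := exists_const_tatePairingPoint_eq_neg_trace_unitRootFrame v (AinfTop.curveFO (v.adicCompletion K) (Wm.map ψm)) e hμ hadd₁ hadd₂
    hgal hcompat hpv ψ hψ hψlog heL healt henondeg
  have hF2 := hF1 hinj hde d hw₀ ρ hρ0 hρw hαπ hu hφu hx hρx hfil hne hρχ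
  obtain ⟨c, hc⟩ := hF2
  clear hF1
  refine ⟨c, fun η P Q hQ hQ0 hker huN cP hcP => ?_⟩
  -- the per-point package
  have hP1 := exists_kummerPackage_through_iota (hp := hpv) (D := Dv) (W := Wm) (E₀ := E₀) hWE (ψ := ψm) hψm hΔ hN hLT hsmul hgen
    A B dHL hHL P Q hQ hQ0 hker huN cP hcP
  obtain ⟨κ, k, Λ, h1, hk, hΛ, hgalΛ, hθ⟩ := hP1
  rw [← haπ] at hΛ
  exact hc η κ P h1 k hk Λ hΛ hgalΛ cP hθ

end Completion

end Literature.NumberTheory.PAdicHodge
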